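import Summits.CriticalPhenomena.PercolationContinuityZ3.Theorems.PercTiltedBlockersWideBoxFromTilt
import HarnessLib

/-!
# Crux `CubeBlockingSeed` (stmt-CriticalPhenomena-1141), line `registered` — helper: the halving rung from a tall tilt comparison (reduction only)

Helper file for the lead's skeleton of the line `registered` (`Cruxes/CubeBlockingSeed/Lines/birth.lean`)
of the crux `Summit.CriticalPhenomena.PercolationContinuityZ3.Theses.PercTiltedBlockers.CubeBlockingSeed`
(shared verbatim with `Theses.PercAnnulusCrossing.CubeBlockingSeed`); lands with
`--supports stmt-CriticalPhenomena-1141`.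

Write `R(h; L, M) = [0,h] × [0,L] × [0,M] ⊆ ℤ³` (`Finset.Icc 0 ![h, L, M]`, `x₀` = height = the blocked
direction), `β(h; L, M) := P_{p_c(ℤ³)}(no open path inside R(h;L,M) from {x₀ = 0} to {x₀ = h})` and
`SeedAt k :≡ ∃ c > 0, ∀ n ≥ 1, β(k n; n, n) ≥ c`. The registered stub `stub_halvingRung` of the line is the
HALVING RUNG `∀ k ≥ 1, SeedAt (2k) → SeedAt k` (blocker-RSW on the tall family; open in print,
Benjamini–Kalai 2018 p. 71). No cheap reduction exists: the proved monotonicities go the wrong way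
(`β` increases with `h` and decreases with `L, M`; from `β(2kn'; n', n') ≥ c` one controls only the shapes
with `h ≥ 2kn'`, `L, M ≤ n'`, never `(kn; n, n)`), and the axis symmetries of `ℤ³` do not compare blocking
across different directions. A genuine single-box shape comparison is needed.

This file proves the rung FROM the minimal tilt comparison on tall shapes that makes the route's squaring
walk go through (`halvingRung_of_tallTilt`, one `k` at a time; `stub_rungOfTallTilt` — registered on the
item as a stub of the line — is `∀ k ≥ 1, TallTilt(k) → SeedAt (2k) → SeedAt k` in the registered spelling). The hypothesis `TallTilt(k)` (inline, no `def`) mirrors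
the route's `TiltComparison` (filed for the FLAT family `h = 4m`, `L, M ∈ [4m, 24m]` only):
`∃ g monotone, g > 0 on (0,∞), ∀ m ≥ 1, ∀ L M ∈ [2m, 5m], ∃ a, g(β(4km; L, M)) ≤ P(Tilt(R(4km;L,M); m, a))`,
`Tilt(R; δ, a)` = "no open path inside `R` from `{x₀ = 0} ∪ {x₁ = L, x₀ < a}` to
`{x₀ = h} ∪ {x₁ = δ, x₀ ≥ a}`" (the route's tilt event). The step `δ = m ≤ L/2` is never degenerate (the
two patches are `≥ m` apart); the range `[2m, 5m]` at height `4km = 2k·(2m)` is what is needed to pass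
from the hypothesis shape `(2k·2m; 2m, 2m)` to every `(kn; n, n)`, `n ∈ [4m, 4m+3] ⊆ [4m, 5m]` (`m ≥ 3`):
BOTH the widening `2m ↦ 4m` of the cross-section AND the remainders `n mod 4`; the eleven scales `n ≤ 11`
use `β > 0` (`p_c(ℤ³) < 1`). Only the instances `L ∈ {2m, 3m, 4m}`, `M ∈ {2m, 5m}` are consumed.

Proof (template `Theorems/PercTiltedBlockersWideBoxFromTilt.lean`; Tassion 2016 §2; Grimmett 1999 §1.6,
Thm. 2.4): `step` — `c ≤ β(4km; L, M)`, `c > 0` ⇒ `g(c)² ≤ β(4km; L+m, M)` (TallTilt + the PROVED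
`tiltSquaring_proof`, `δ = m`); `real_blocked_mono_height` — `h ≤ h' ⇒ β(h;L,M) ≤ β(h';L,M)` (clip a
lattice crossing at the level `x₀ = h`, `exists_openConnIn_le_level`, a.e. lattice reduction
`DCT16.real_mono_of_forall_subset_edgeSet`; the RAW events are not nested, cf. `not_TiltGluing`);
`real_blocked_anti_width` — `L ≤ L'`, `M ≤ M'` ⇒ `β(h;L',M') ≤ β(h;L,M)` (`openConnIn_mono`);
`real_blocked_pos` — `h ≥ 1 ⇒ β(h;L,M) > 0` (`le_bondPercolation_real_forall_notMem`,
`criticalProb_zd_lt_one`); `iterate` — the arithmetic for an abstract `B(h,L,M)`: seed `B(4km; 2m, 2m) ≥ c₀`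
(hypothesis at `n = 2m`), walk `L = 2m → 5m` at `M = 2m`, swap the horizontal axes
(`tilt_real_blocked_swap`), walk again at `M = 5m`; `c₆ = f⁶(c₀)`, `f(c) = g(c)²`, independent of `m`;
for `n ≥ 12`, `m = ⌊n/4⌋`: `c₆ ≤ B(4km; 5m, 5m) ≤ B(4km; n, n) ≤ B(kn; n, n)`; a finite positive floor
for `n ≤ 11`. No new definitions; nothing is claimed about `TallTilt(k)` itself (NOT in tree; a
Benjamini–Kalai-type tilt comparison at `p_c` on tall shapes, open in print).
-/

noncomputable section

namespace Summit.CriticalPhenomena.PercolationContinuityZ3.Theorems.CubeBlockingSeed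

open MeasureTheory Literature.Probability.Percolation Literature.Probability.LatticeModels

namespace RungOfTallTilt

/-! ### Monotonicity, positivity and the finite floor for `β_p(h; L, M)` -/

/-- **Height monotonicity** (taller boxes over the same cross-section are easier to block), for
probabilities and every `p`: `h ≤ h' → β_p(h; L, M) ≤ β_p(h'; L, M)`. `P_p` is carried by lattice
configurations `ω ⊆ E(ℤ³)` (`DCT16.real_mono_of_forall_subset_edgeSet`); for such `ω` an open path
inside `R(h'; L, M)` from `x` (`x₀ = 0`) to `y` (`y₀ = h' ≥ h`) is clipped at its first visit to the
level `x₀ = h` (`exists_openConnIn_le_level`), and the clipped path lies in `R(h; L, M)`. [folklore] -/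
theorem real_blocked_mono_height (p : unitInterval) {h h' : ℕ} (hle : h ≤ h') (LL MM : ℤ) :
    (bondPercolation (zdGraph 3) p).real
        {ω | ¬ ∃ x ∈ Finset.Icc (0 : Site 3) ![(h : ℤ), LL, MM],
          ∃ y ∈ Finset.Icc (0 : Site 3) ![(h : ℤ), LL, MM],
            x 0 = 0 ∧ y 0 = (h : ℤ) ∧ ω ∈ openConnIn ↑(Finset.Icc (0 : Site 3) ![(h : ℤ), LL, MM]) x y} ≤
      (bondPercolation (zdGraph 3) p).real
        {ω | ¬ ∃ x ∈ Finset.Icc (0 : Site 3) ![(h' : ℤ), LL, MM],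
          ∃ y ∈ Finset.Icc (0 : Site 3) ![(h' : ℤ), LL, MM],
            x 0 = 0 ∧ y 0 = (h' : ℤ) ∧ ω ∈ openConnIn ↑(Finset.Icc (0 : Site 3) ![(h' : ℤ), LL, MM]) x y} := by
  -- adapted from the skeleton's `blockP_mono_height` (Cruxes/CubeBlockingSeed/Lines/birth.lean)
  refine DCT16.real_mono_of_forall_subset_edgeSet (zdGraph 3) p fun ω hω hb => ?_
  rintro ⟨x, hx, y, hy, hx0, hy0, hxy⟩
  have hxR := TiltSquaring.mem_box0.1 hx
  have hyR := TiltSquaring.mem_box0.1 hy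
  obtain ⟨z, hz, hr⟩ := exists_openConnIn_le_level (G := zdGraph 3) hω (fun w : Site 3 => w 0)
    (fun u w huw => (zdGraph_adj_apply_le huw 0).1) (h : ℤ) (show x 0 ≤ (h : ℤ) by omega)
    (show (h : ℤ) ≤ y 0 by rw [hy0]; exact_mod_cast hle) hxy
  obtain ⟨hzS, hzh⟩ := hr.2.1
  have hzR := TiltSquaring.mem_box0.1 (Finset.mem_coe.1 hzS)
  have hzh' : z 0 ≤ (h : ℤ) := hzh
  refine hb ⟨x, TiltSquaring.mem_box0.2 ?_, z, TiltSquaring.mem_box0.2 ?_, hx0, hz,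
    openConnIn_mono (fun w hw => ?_) x z hr⟩
  · omega
  · omega
  · obtain ⟨hw1, hw2⟩ := hw
    have hwR := TiltSquaring.mem_box0.1 (Finset.mem_coe.1 hw1)
    have hw2' : w 0 ≤ (h : ℤ) := hw2
    exact Finset.mem_coe.2 (TiltSquaring.mem_box0.2 (by omega))

/-- **Width anti-monotonicity** (wider boxes of the same height are harder to block), for every `p`
and as a RAW inclusion of events: `L ≤ L' → M ≤ M' → β_p(h; L', M') ≤ β_p(h; L, M)` — an open
bottom-to-top path inside the narrow box is one inside the wide box (`openConnIn_mono`). [folklore] -/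
theorem real_blocked_anti_width (p : unitInterval) (hh : ℤ) {LL LL' MM MM' : ℤ} (hL : LL ≤ LL')
    (hM : MM ≤ MM') :
    (bondPercolation (zdGraph 3) p).real
        {ω | ¬ ∃ x ∈ Finset.Icc (0 : Site 3) ![hh, LL', MM'],
          ∃ y ∈ Finset.Icc (0 : Site 3) ![hh, LL', MM'],
            x 0 = 0 ∧ y 0 = hh ∧ ω ∈ openConnIn ↑(Finset.Icc (0 : Site 3) ![hh, LL', MM']) x y} ≤
      (bondPercolation (zdGraph 3) p).real
        {ω | ¬ ∃ x ∈ Finset.Icc (0 : Site 3) ![hh, LL, MM],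
          ∃ y ∈ Finset.Icc (0 : Site 3) ![hh, LL, MM],
            x 0 = 0 ∧ y 0 = hh ∧ ω ∈ openConnIn ↑(Finset.Icc (0 : Site 3) ![hh, LL, MM]) x y} := by
  have hsub : (↑(Finset.Icc (0 : Site 3) ![hh, LL, MM]) : Set (Site 3)) ⊆
      ↑(Finset.Icc (0 : Site 3) ![hh, LL', MM']) := by
    intro w hw
    have hwR := TiltSquaring.mem_box0.1 (Finset.mem_coe.1 hw)
    exact Finset.mem_coe.2 (TiltSquaring.mem_box0.2 (by omega))
  refine measureReal_mono (fun ω hω => ?_)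
  rintro ⟨x, hx, y, hy, hx0, hy0, hxy⟩
  exact hω ⟨x, Finset.mem_coe.1 (hsub (Finset.mem_coe.2 hx)), y,
    Finset.mem_coe.1 (hsub (Finset.mem_coe.2 hy)), hx0, hy0, openConnIn_mono hsub x y hxy⟩

/-- **Positivity for every fixed box** at `p_c(ℤ³) < 1` (`criticalProb_zd_lt_one`): for `h ≥ 1`,
`0 < (1 - p_c)^{N} ≤ β_{p_c}(h; L, M)`, `N` = the number of unordered pairs of box vertices — if every
such pair is closed (`le_bondPercolation_real_forall_notMem`) an open path inside the box has no first
step, and the trivial path does not cross since `x₀ = 0 ≠ h = y₀`. [folklore] -/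
theorem real_blocked_pos {h : ℕ} (hh1 : 1 ≤ h) (LL MM : ℤ) :
    0 < (bondPercolation (zdGraph 3) (criticalProbI 3)).real
        {ω | ¬ ∃ x ∈ Finset.Icc (0 : Site 3) ![(h : ℤ), LL, MM],
          ∃ y ∈ Finset.Icc (0 : Site 3) ![(h : ℤ), LL, MM],
            x 0 = 0 ∧ y 0 = (h : ℤ) ∧ ω ∈ openConnIn ↑(Finset.Icc (0 : Site 3) ![(h : ℤ), LL, MM]) x y} := by
  set R : Finset (Site 3) := Finset.Icc (0 : Site 3) ![(h : ℤ), LL, MM] with hR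
  have hp : ((criticalProbI 3 : unitInterval) : ℝ) < 1 := criticalProb_zd_lt_one (by norm_num)
  have h1 := le_bondPercolation_real_forall_notMem (zdGraph 3) (criticalProbI 3) R.sym2
  have h2 : (bondPercolation (zdGraph 3) (criticalProbI 3)).real {ω | ∀ e ∈ R.sym2, e ∉ ω} ≤
      (bondPercolation (zdGraph 3) (criticalProbI 3)).real
        {ω | ¬ ∃ x ∈ R, ∃ y ∈ R, x 0 = 0 ∧ y 0 = (h : ℤ) ∧ ω ∈ openConnIn ↑R x y} := by
    refine measureReal_mono (fun ω hω => ?_)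
    have hω' : ∀ e ∈ R.sym2, e ∉ ω := hω
    rintro ⟨x, hx, y, hy, hx0, hy0, hxy⟩
    obtain ⟨-, hr⟩ := DCT16.pathIn_of_mem_openConnIn hxy
    rcases Relation.ReflTransGen.cases_head hr with hxy' | ⟨z, ⟨hadj, hz⟩, -⟩
    · subst hxy'
      omega
    · exact hω' _ (Finset.mk_mem_sym2_iff.2 ⟨hx, Finset.mem_coe.1 hz⟩)
        ((openGraph_adj ω x z).1 hadj).1
  exact lt_of_lt_of_le (pow_pos (by linarith) _) (h1.trans h2)

/-- A finite family of positive reals indexed by `1 ≤ n ≤ N` has a common positive lower bound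
(induction on `N`). [folklore] -/
theorem exists_pos_forall_le {q : ℕ → ℝ} (hq : ∀ n : ℕ, 1 ≤ n → 0 < q n) (N : ℕ) :
    ∃ c : ℝ, 0 < c ∧ ∀ n : ℕ, 1 ≤ n → n ≤ N → c ≤ q n := by
  -- adapted from `StubBlockerRSWGlue.exists_pos_forall_le_blockProb`
  induction N with
  | zero => exact ⟨1, one_pos, fun n hn hn0 => by omega⟩
  | succ N ih =>
    obtain ⟨c, hc, h⟩ := ih
    refine ⟨min c (q (N + 1)), lt_min hc (hq (N + 1) (Nat.succ_pos N)), fun n hn hnN => ?_⟩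
    rcases Nat.lt_or_ge n (N + 1) with hlt | hge
    · exact (min_le_left _ _).trans (h n hn (Nat.lt_succ_iff.mp hlt))
    · obtain rfl : n = N + 1 := le_antisymm hnN hge
      exact min_le_right _ _

/-! ### One squaring step on the tall family and the walk -/

/-- **One squaring step at `p = p_c(ℤ³)` on the tall family** `h = 4km`, `L, M ∈ [2m, 5m]`, `δ = m`:
if `c ≤ β(4km; L, M)` with `c > 0` then `g(c)² ≤ β(4km; L + m, M)` — the tall tilt comparison at the
level `a` it provides, then the PROVED squaring step `tiltSquaring_proof` (`δ = m ≤ L`), monotonicity and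
positivity of `g`. Mirrors `Theorems.tilt_step`. [folklore] -/
theorem step {k : ℕ} {g : ℝ → ℝ} (hgmono : Monotone g) (hgpos : ∀ s, 0 < s → 0 < g s)
    (hT : ∀ m L M : ℕ, 1 ≤ m → 2 * m ≤ L → L ≤ 5 * m → 2 * m ≤ M → M ≤ 5 * m → ∃ a : ℕ,
      g ((bondPercolation (zdGraph 3) (criticalProbI 3)).real
        {ω | ¬ ∃ x ∈ Finset.Icc (0 : Site 3) ![((4 * k * m : ℕ) : ℤ), L, M],
          ∃ y ∈ Finset.Icc (0 : Site 3) ![((4 * k * m : ℕ) : ℤ), L, M],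
            x 0 = 0 ∧ y 0 = ((4 * k * m : ℕ) : ℤ) ∧
              ω ∈ openConnIn ↑(Finset.Icc (0 : Site 3) ![((4 * k * m : ℕ) : ℤ), L, M]) x y}) ≤
      (bondPercolation (zdGraph 3) (criticalProbI 3)).real
        {ω | ¬ ∃ x ∈ Finset.Icc (0 : Site 3) ![((4 * k * m : ℕ) : ℤ), L, M],
          ∃ y ∈ Finset.Icc (0 : Site 3) ![((4 * k * m : ℕ) : ℤ), L, M],
            (x 0 = 0 ∨ (x 1 = L ∧ x 0 < a)) ∧ (y 0 = ((4 * k * m : ℕ) : ℤ) ∨ (y 1 = m ∧ (a : ℤ) ≤ y 0)) ∧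
              ω ∈ openConnIn ↑(Finset.Icc (0 : Site 3) ![((4 * k * m : ℕ) : ℤ), L, M]) x y})
    {m L M : ℕ} (hm : 1 ≤ m) (hL : 2 * m ≤ L) (hL' : L ≤ 5 * m) (hM : 2 * m ≤ M) (hM' : M ≤ 5 * m)
    {c : ℝ} (hc : 0 < c)
    (hcle : c ≤ (bondPercolation (zdGraph 3) (criticalProbI 3)).real
        {ω | ¬ ∃ x ∈ Finset.Icc (0 : Site 3) ![((4 * k * m : ℕ) : ℤ), L, M],
          ∃ y ∈ Finset.Icc (0 : Site 3) ![((4 * k * m : ℕ) : ℤ), L, M],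
            x 0 = 0 ∧ y 0 = ((4 * k * m : ℕ) : ℤ) ∧
              ω ∈ openConnIn ↑(Finset.Icc (0 : Site 3) ![((4 * k * m : ℕ) : ℤ), L, M]) x y}) :
    (g c) ^ 2 ≤ (bondPercolation (zdGraph 3) (criticalProbI 3)).real
        {ω | ¬ ∃ x ∈ Finset.Icc (0 : Site 3) ![((4 * k * m : ℕ) : ℤ), ((L + m : ℕ) : ℤ), M],
          ∃ y ∈ Finset.Icc (0 : Site 3) ![((4 * k * m : ℕ) : ℤ), ((L + m : ℕ) : ℤ), M],
            x 0 = 0 ∧ y 0 = ((4 * k * m : ℕ) : ℤ) ∧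
              ω ∈ openConnIn ↑(Finset.Icc (0 : Site 3) ![((4 * k * m : ℕ) : ℤ), ((L + m : ℕ) : ℤ), M]) x y} := by
  obtain ⟨a, ha⟩ := hT m L M hm hL hL' hM hM'
  have hsq := tiltSquaring_proof (criticalProbI 3) (4 * k * m) L M m a (by omega)
  exact (pow_le_pow_left₀ (hgpos c hc).le ((hgmono hcle).trans ha) 2).trans hsq

/-- **The walk and its bookkeeping**, for an abstract `B(h, L, M)` (the blocking probability of
`R(h;L,M)` at `p_c`): from the seed `B(2kn; n, n) ≥ c₀` (all `n ≥ 1`), the step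
`c ≤ B(4km; L, M) ⇒ g(c)² ≤ B(4km; L+m, M)` on `L, M ∈ [2m, 5m]`, the swap symmetry, height
monotonicity, width anti-monotonicity and positivity for `h ≥ 1`, conclude `B(kn; n, n) ≥ c > 0` for all
`n ≥ 1`: six squaring steps `(4km; 2m, 2m) → (4km; 5m, 2m) ↦ (4km; 2m, 5m) → (4km; 5m, 5m)` with
constants `c_{j+1} = g(c_j)²` independent of `m`; for `n ≥ 12` and `m = ⌊n/4⌋ ≥ 3` one has
`4m ≤ n ≤ 5m`, so `B(kn; n, n) ≥ B(4km; n, n) ≥ B(4km; 5m, 5m) ≥ c₆`; the eleven scales `n ≤ 11` have a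
common positive floor. [folklore] -/
theorem iterate {k : ℕ} (hk : 1 ≤ k) {B : ℤ → ℤ → ℤ → ℝ} {g : ℝ → ℝ}
    (hgpos : ∀ s, 0 < s → 0 < g s) {c₀ : ℝ} (hc₀ : 0 < c₀)
    (hseed : ∀ n : ℕ, 1 ≤ n → c₀ ≤ B ((2 * k * n : ℕ) : ℤ) n n)
    (hstep : ∀ m L M : ℕ, 1 ≤ m → 2 * m ≤ L → L ≤ 5 * m → 2 * m ≤ M → M ≤ 5 * m →
      ∀ c : ℝ, 0 < c → c ≤ B ((4 * k * m : ℕ) : ℤ) L M →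
        (g c) ^ 2 ≤ B ((4 * k * m : ℕ) : ℤ) ((L + m : ℕ) : ℤ) M)
    (hswap : ∀ hh LL MM : ℤ, B hh LL MM = B hh MM LL)
    (hheight : ∀ (h h' : ℕ) (LL MM : ℤ), h ≤ h' → B h LL MM ≤ B h' LL MM)
    (hwidth : ∀ hh LL LL' MM MM' : ℤ, LL ≤ LL' → MM ≤ MM' → B hh LL' MM' ≤ B hh LL MM)
    (hpos : ∀ (h : ℕ) (LL MM : ℤ), 1 ≤ h → 0 < B h LL MM) :
    ∃ c : ℝ, 0 < c ∧ ∀ n : ℕ, 1 ≤ n → c ≤ B ((k * n : ℕ) : ℤ) n n := by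
  set f : ℝ → ℝ := fun s => (g s) ^ 2 with hf
  have hfpos : ∀ s, 0 < s → 0 < f s := fun s hs => by rw [hf]; exact pow_pos (hgpos s hs) 2
  have hcpos : ∀ j, 0 < f^[j] c₀ := by
    intro j
    induction j with
    | zero => simpa using hc₀
    | succ j ih => rw [Function.iterate_succ_apply']; exact hfpos _ ih
  -- the seed of the walk: the hypothesis at `n = 2m`
  have seed : ∀ m : ℕ, 1 ≤ m →
      c₀ ≤ B ((4 * k * m : ℕ) : ℤ) ((2 * m : ℕ) : ℤ) ((2 * m : ℕ) : ℤ) := by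
    intro m hm
    have h := hseed (2 * m) (by omega)
    have e : 2 * k * (2 * m) = 4 * k * m := by ring
    rw [e] at h
    exact h
  -- first walk, `L = 2m → 5m` at `M = 2m`
  have walk1 : ∀ j, j ≤ 3 → ∀ m : ℕ, 1 ≤ m →
      f^[j] c₀ ≤ B ((4 * k * m : ℕ) : ℤ) (((2 + j) * m : ℕ) : ℤ) ((2 * m : ℕ) : ℤ) := by
    intro j
    induction j with
    | zero =>
      intro _ m hm
      have e1 : ((2 + 0) * m : ℕ) = 2 * m := by ring
      rw [e1, Function.iterate_zero_apply]
      exact seed m hm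
    | succ j ih =>
      intro hj m hm
      have h := hstep m ((2 + j) * m) (2 * m) hm (Nat.mul_le_mul_right m (by omega))
        (Nat.mul_le_mul_right m (by omega)) le_rfl (by omega) _ (hcpos j) (ih (by omega) m hm)
      have e : ((2 + j) * m + m : ℕ) = (2 + (j + 1)) * m := by ring
      rw [e] at h
      rw [Function.iterate_succ_apply']
      exact h
  -- swap the horizontal axes
  have mid : ∀ m : ℕ, 1 ≤ m →
      f^[3] c₀ ≤ B ((4 * k * m : ℕ) : ℤ) ((2 * m : ℕ) : ℤ) ((5 * m : ℕ) : ℤ) := by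
    intro m hm
    have h := walk1 3 le_rfl m hm
    have e : ((2 + 3) * m : ℕ) = 5 * m := by ring
    rw [e] at h
    rw [hswap]; exact h
  -- second walk, `L = 2m → 5m` at `M = 5m`
  have walk2 : ∀ j, j ≤ 3 → ∀ m : ℕ, 1 ≤ m →
      f^[3 + j] c₀ ≤ B ((4 * k * m : ℕ) : ℤ) (((2 + j) * m : ℕ) : ℤ) ((5 * m : ℕ) : ℤ) := by
    intro j
    induction j with
    | zero =>
      intro _ m hm
      have e1 : ((2 + 0) * m : ℕ) = 2 * m := by ring
      rw [e1]; exact mid m hm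
    | succ j ih =>
      intro hj m hm
      have h := hstep m ((2 + j) * m) (5 * m) hm (Nat.mul_le_mul_right m (by omega))
        (Nat.mul_le_mul_right m (by omega)) (by omega) le_rfl _ (hcpos (3 + j)) (ih (by omega) m hm)
      have e : ((2 + j) * m + m : ℕ) = (2 + (j + 1)) * m := by ring
      rw [e] at h
      rw [show 3 + (j + 1) = (3 + j) + 1 by ring, Function.iterate_succ_apply']
      exact h
  have wide : ∀ m : ℕ, 1 ≤ m →
      f^[6] c₀ ≤ B ((4 * k * m : ℕ) : ℤ) ((5 * m : ℕ) : ℤ) ((5 * m : ℕ) : ℤ) := by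
    intro m hm
    have h := walk2 3 le_rfl m hm
    have e : ((2 + 3) * m : ℕ) = 5 * m := by ring
    rw [e] at h
    exact h
  -- small scales: a common positive floor for `n ≤ 11`
  obtain ⟨c₁, hc₁, hsmall⟩ : ∃ c₁ : ℝ, 0 < c₁ ∧ ∀ n : ℕ, 1 ≤ n → n ≤ 11 →
      c₁ ≤ B ((k * n : ℕ) : ℤ) n n :=
    exists_pos_forall_le (q := fun n => B ((k * n : ℕ) : ℤ) n n)
      (fun n hn => hpos (k * n) n n (Nat.mul_pos hk hn)) 11
  refine ⟨min (f^[6] c₀) c₁, lt_min (hcpos 6) hc₁, fun n hn => ?_⟩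
  rcases Nat.lt_or_ge n 12 with hlt | hge
  · exact (min_le_right _ _).trans (hsmall n hn (by omega))
  · -- large scales: `m = ⌊n/4⌋ ≥ 3`, `4m ≤ n ≤ 5m`
    set m : ℕ := n / 4 with hm
    have hm3 : 3 ≤ m := by omega
    have h4 : 4 * m ≤ n := by omega
    have h5 : (n : ℤ) ≤ ((5 * m : ℕ) : ℤ) := by push_cast; omega
    have h4k : 4 * k * m ≤ k * n :=
      calc 4 * k * m = k * (4 * m) := by ring
        _ ≤ k * n := Nat.mul_le_mul_left k h4
    calc min (f^[6] c₀) c₁ ≤ f^[6] c₀ := min_le_left _ _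
      _ ≤ B ((4 * k * m : ℕ) : ℤ) ((5 * m : ℕ) : ℤ) ((5 * m : ℕ) : ℤ) := wide m (by omega)
      _ ≤ B ((4 * k * m : ℕ) : ℤ) n n := hwidth _ _ _ _ _ h5 h5
      _ ≤ B ((k * n : ℕ) : ℤ) n n := hheight _ _ _ _ h4k

end RungOfTallTilt

/-! ### The reduction -/

/-- **The halving rung from a tall tilt comparison** (one aspect ratio `k ≥ 1` at a time). HYPOTHESIS
`TallTilt(k)` (inline; NOT in tree, a Benjamini–Kalai-type statement at `p_c(ℤ³)`, open in print): one
monotone `g`, `g > 0` on `(0,∞)`, such that for all `m ≥ 1` and `L, M ∈ [2m, 5m]` there is a level `a`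
with `g(β(4km; L, M)) ≤ P_{p_c}(Tilt(R(4km; L, M); m, a))`, `Tilt` = no open path inside the box from
`{x₀ = 0} ∪ {x₁ = L, x₀ < a}` to `{x₀ = 4km} ∪ {x₁ = m, x₀ ≥ a}` (the route's tilt event, step
`δ = m ≤ L/2`, never degenerate). CONCLUSION: `SeedAt (2k) → SeedAt k`, i.e. if the boxes
`[0,2kn]×[0,n]²` are blocked lengthwise at `p_c` with probability `≥ c₀ > 0` for all `n ≥ 1` then the
boxes `[0,kn]×[0,n]²` are blocked with probability `≥ c > 0` for all `n ≥ 1`. Proof: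
`RungOfTallTilt.iterate` instantiated with the blocking probability (`step` = TallTilt +
`tiltSquaring_proof`; `tilt_real_blocked_swap`; height/width monotonicity; positivity at `p_c < 1`).
[folklore] -/
theorem halvingRung_of_tallTilt {k : ℕ} (hk : 1 ≤ k)
    (hT : ∃ g : ℝ → ℝ, Monotone g ∧ (∀ s, 0 < s → 0 < g s) ∧
      ∀ m L M : ℕ, 1 ≤ m → 2 * m ≤ L → L ≤ 5 * m → 2 * m ≤ M → M ≤ 5 * m → ∃ a : ℕ,
        g ((bondPercolation (zdGraph 3) (criticalProbI 3)).real
          {ω | ¬ ∃ x ∈ Finset.Icc (0 : Site 3) ![((4 * k * m : ℕ) : ℤ), L, M],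
            ∃ y ∈ Finset.Icc (0 : Site 3) ![((4 * k * m : ℕ) : ℤ), L, M],
              x 0 = 0 ∧ y 0 = ((4 * k * m : ℕ) : ℤ) ∧
                ω ∈ openConnIn ↑(Finset.Icc (0 : Site 3) ![((4 * k * m : ℕ) : ℤ), L, M]) x y}) ≤
        (bondPercolation (zdGraph 3) (criticalProbI 3)).real
          {ω | ¬ ∃ x ∈ Finset.Icc (0 : Site 3) ![((4 * k * m : ℕ) : ℤ), L, M],
            ∃ y ∈ Finset.Icc (0 : Site 3) ![((4 * k * m : ℕ) : ℤ), L, M],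
              (x 0 = 0 ∨ (x 1 = L ∧ x 0 < a)) ∧
                (y 0 = ((4 * k * m : ℕ) : ℤ) ∨ (y 1 = m ∧ (a : ℤ) ≤ y 0)) ∧
                ω ∈ openConnIn ↑(Finset.Icc (0 : Site 3) ![((4 * k * m : ℕ) : ℤ), L, M]) x y})
    (hS : ∃ c : ℝ, 0 < c ∧ ∀ n : ℕ, 1 ≤ n →
      c ≤ (bondPercolation (zdGraph 3) (criticalProbI 3)).real
        {ω | ¬ ∃ x ∈ Finset.Icc (0 : Site 3) ![((2 * k * n : ℕ) : ℤ), n, n],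
          ∃ y ∈ Finset.Icc (0 : Site 3) ![((2 * k * n : ℕ) : ℤ), n, n],
            x 0 = 0 ∧ y 0 = ((2 * k * n : ℕ) : ℤ) ∧
              ω ∈ openConnIn ↑(Finset.Icc (0 : Site 3) ![((2 * k * n : ℕ) : ℤ), n, n]) x y}) :
    ∃ c : ℝ, 0 < c ∧ ∀ n : ℕ, 1 ≤ n →
      c ≤ (bondPercolation (zdGraph 3) (criticalProbI 3)).real
        {ω | ¬ ∃ x ∈ Finset.Icc (0 : Site 3) ![((k * n : ℕ) : ℤ), n, n],
          ∃ y ∈ Finset.Icc (0 : Site 3) ![((k * n : ℕ) : ℤ), n, n],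
            x 0 = 0 ∧ y 0 = ((k * n : ℕ) : ℤ) ∧
              ω ∈ openConnIn ↑(Finset.Icc (0 : Site 3) ![((k * n : ℕ) : ℤ), n, n]) x y} := by
  obtain ⟨g, hgmono, hgpos, hT⟩ := hT
  obtain ⟨c₀, hc₀, hS⟩ := hS
  exact RungOfTallTilt.iterate hk
    (B := fun hh LL MM => (bondPercolation (zdGraph 3) (criticalProbI 3)).real
      {ω | ¬ ∃ x ∈ Finset.Icc (0 : Site 3) ![hh, LL, MM], ∃ y ∈ Finset.Icc (0 : Site 3) ![hh, LL, MM],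
        x 0 = 0 ∧ y 0 = hh ∧ ω ∈ openConnIn ↑(Finset.Icc (0 : Site 3) ![hh, LL, MM]) x y})
    hgpos hc₀ hS
    (fun m L M hm hL hL' hM hM' c hc hcle =>
      RungOfTallTilt.step hgmono hgpos hT hm hL hL' hM hM' hc hcle)
    (fun hh LL MM => tilt_real_blocked_swap (criticalProbI 3) hh LL MM)
    (fun h h' LL MM hle => RungOfTallTilt.real_blocked_mono_height (criticalProbI 3) hle LL MM)
    (fun hh LL LL' MM MM' hL hM => RungOfTallTilt.real_blocked_anti_width (criticalProbI 3) hh hL hM)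
    (fun h LL MM hh1 => RungOfTallTilt.real_blocked_pos hh1 LL MM)

/-- **STUB `stub_rungOfTallTilt` of the line** (proposed re-split of the registered `stub_halvingRung` into
`stub_tallTilt k` = the tall tilt comparison `TallTilt(k)` (OPEN) and this PROVED rung, pointwise in the
aspect ratio `k ≥ 1`): `∀ k ≥ 1, TallTilt(k) → SeedAt (2k) → SeedAt k`, the last two written verbatim as in
the registered text of `stub_halvingRung` (`= HalvingRung`); it is `halvingRung_of_tallTilt`. [folklore] -/
theorem stub_rungOfTallTilt :
    ∀ k : ℕ, 1 ≤ k →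
      (∃ g : ℝ → ℝ, Monotone g ∧ (∀ s, 0 < s → 0 < g s) ∧
        ∀ m L M : ℕ, 1 ≤ m → 2 * m ≤ L → L ≤ 5 * m → 2 * m ≤ M → M ≤ 5 * m → ∃ a : ℕ,
          g ((bondPercolation (zdGraph 3) (criticalProbI 3)).real
            {ω | ¬ ∃ x ∈ Finset.Icc (0 : Site 3) ![((4 * k * m : ℕ) : ℤ), L, M],
              ∃ y ∈ Finset.Icc (0 : Site 3) ![((4 * k * m : ℕ) : ℤ), L, M],
                x 0 = 0 ∧ y 0 = ((4 * k * m : ℕ) : ℤ) ∧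
                  ω ∈ openConnIn ↑(Finset.Icc (0 : Site 3) ![((4 * k * m : ℕ) : ℤ), L, M]) x y}) ≤
          (bondPercolation (zdGraph 3) (criticalProbI 3)).real
            {ω | ¬ ∃ x ∈ Finset.Icc (0 : Site 3) ![((4 * k * m : ℕ) : ℤ), L, M],
              ∃ y ∈ Finset.Icc (0 : Site 3) ![((4 * k * m : ℕ) : ℤ), L, M],
                (x 0 = 0 ∨ (x 1 = L ∧ x 0 < a)) ∧
                  (y 0 = ((4 * k * m : ℕ) : ℤ) ∨ (y 1 = m ∧ (a : ℤ) ≤ y 0)) ∧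
                  ω ∈ openConnIn ↑(Finset.Icc (0 : Site 3) ![((4 * k * m : ℕ) : ℤ), L, M]) x y}) →
      (∃ c : ℝ, 0 < c ∧ ∀ n : ℕ, 1 ≤ n →
        c ≤ (bondPercolation (zdGraph 3) (criticalProbI 3)).real
          {ω | ¬ ∃ x ∈ Finset.Icc (0 : Site 3) ![((2 * k * n : ℕ) : ℤ), n, n],
            ∃ y ∈ Finset.Icc (0 : Site 3) ![((2 * k * n : ℕ) : ℤ), n, n],
              x 0 = 0 ∧ y 0 = ((2 * k * n : ℕ) : ℤ) ∧
                ω ∈ openConnIn ↑(Finset.Icc (0 : Site 3) ![((2 * k * n : ℕ) : ℤ), n, n]) x y}) →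
      ∃ c : ℝ, 0 < c ∧ ∀ n : ℕ, 1 ≤ n →
        c ≤ (bondPercolation (zdGraph 3) (criticalProbI 3)).real
          {ω | ¬ ∃ x ∈ Finset.Icc (0 : Site 3) ![((k * n : ℕ) : ℤ), n, n],
            ∃ y ∈ Finset.Icc (0 : Site 3) ![((k * n : ℕ) : ℤ), n, n],
              x 0 = 0 ∧ y 0 = ((k * n : ℕ) : ℤ) ∧
                ω ∈ openConnIn ↑(Finset.Icc (0 : Site 3) ![((k * n : ℕ) : ℤ), n, n]) x y} :=
  fun _ hk hT hS => halvingRung_of_tallTilt hk hT hS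

end Summit.CriticalPhenomena.PercolationContinuityZ3.Theorems.CubeBlockingSeed

end
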